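import Mathlib
import HarnessLib
import Summits.ResolutionOfSingularities.ResolutionOfSingularities.Theorems.WildQuotientsWildQuotientResolutionBlowupExitCoverEngineDeg
import Summits.ResolutionOfSingularities.ResolutionOfSingularities.Theorems.WildQuotientsWildQuotientResolutionConductorOneFrameNormElt
import Summits.ResolutionOfSingularities.ResolutionOfSingularities.Theorems.WildQuotientsWildQuotientResolutionConductorOneFrameChartMapInj
import Summits.ResolutionOfSingularities.ResolutionOfSingularities.Theorems.WildQuotientsWildQuotientResolutionConductorOneFrameDict
import Summits.ResolutionOfSingularities.ResolutionOfSingularities.Theorems.WildQuotientsWildQuotientResolutionConductorOneChartSigma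

/-!
# S2 brick F3c-4b — the FRAME of the conductor-𝟙 core: the algebra `(Aₙ[𝔪t])_{(N_{i,I})} ≃ M_I = k[s,c,e][h_M⁻¹]`

(crux stmt-ResolutionOfSingularities-15640 `WildQuotients.WildQuotientResolution`, line `Sketch`; chain w45c post-V5
programme S2, design `L/res-L1-w45c-lead-1/S2-DESIGN.md` §1/§7 (the straightened chart ring of the piece `O_I`);
res-L1-w45c-plan-1 NO OBJECTION 2026-08-27T18:26:16Z (F3c «A_I via the cover engine»). [OURS · L1 W4.5c] — NOT a
statement of any manuscript; replaces the role of no printed item; AI-produced, weaker than expert review. Def-free.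
Prover res-D-pv-033.)

**`exists_awayEquiv_chartRing`** — for `i ∈ I` there are the chart map `β : Aₙ →ₐ[k] M_I` of F3c-1 (with its three
laws) and a ring isomorphism `A : (Aₙ[𝔪t])_{(N_{i,I})} ≃+* ChartRing k p n i I` with `A (r/1) = β r` — the degree-`d`
cover engine `BlowupExit.exists_ringEquiv_subalgebra_of_coverData_deg` with `T = uᵢ`, `N_{i,I} = (uᵢt)·g`,
`g = (uᵢt)^{p−1}wᵢ · ∏ (u_lt)^p w_l · ∏ ((uᵢ−u_l)t)^p wᵢw_l` (degree `d = (p−1) + |I∖i|p + |Iᶜ|p`), `U = M_I`, `S = ⊤`,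
generators `X_l` and `h_M⁻¹`, and the dictionary of F3c-4a (`c_l = β((uᵢ−u_l)·G/u_l)/βG`, `e_l = β(u_l·G/(uᵢ−u_l))/βG`,
`h_M⁻¹ = β(wᵢ ∏ T_l ∏ (uᵢ−u_l)^p w_l)/s^{|I∖i|p+|Iᶜ|p}`). Auxiliary: `algebraMap_chartDen_eq_prod` (lead-1's `chartDen_ne_zero`, `chartRing_isDomain` from `…ChartSigma`).
-/

-- single-problem summit: the doubled namespace component `ResolutionOfSingularities` is forced
set_option linter.dupNamespace false

noncomputable section

open CategoryTheory AlgebraicGeometry MvPolynomial Polynomial HomogeneousLocalization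
open Literature.AlgebraicGeometry.Resolution

namespace Summit.ResolutionOfSingularities.ResolutionOfSingularities.Theorems.WildQuotientResolution.ConductorOne

variable (k : Type) [Field k] (p n : ℕ) [Fact p.Prime] [CharP k p] (i : Fin n) (I : Finset (Fin n))

/-- the Rees generator `uₗ t` -/
local notation3 (prettyPrint := false) "uT" l =>
  reesT (I := Ideal.span (Set.range (coreU k p n))) (coreU k p n l)
    (Ideal.mem_span_range_self (f := coreU k p n) (x := l))
/-- the Rees element `(uᵢ − uₗ) t` -/
local notation3 (prettyPrint := false) "dT" i:max l:max =>
  reesT (I := Ideal.span (Set.range (coreU k p n))) (coreU k p n i - coreU k p n l)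
    (Ideal.sub_mem _ (Ideal.mem_span_range_self (f := coreU k p n) (x := i))
      (Ideal.mem_span_range_self (f := coreU k p n) (x := l)))
/-- the inverse `w_l = (1 − u_l^{p−1})⁻¹` in `Aₙ` -/
local notation3 (prettyPrint := false) "cw" l => (((isUnit_coreFactor k p n l).unit⁻¹ : (CoreRing k p n)ˣ) :
  CoreRing k p n)
/-- the norm radicand `N_{il}` -/
local notation3 (prettyPrint := false) "nD" i:max l:max =>
  ((coreU k p n i - coreU k p n l) ^ p * ((cw i) * (cw l)))
/-- the norm factor `(u_l t)^p · w_l` -/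
local notation3 (prettyPrint := false) "nT" l =>
  ((uT l) ^ p * algebraMap (CoreRing k p n) (reesAlgebra (Ideal.span (Set.range (coreU k p n))))
    (((isUnit_coreFactor k p n l).unit⁻¹ : (CoreRing k p n)ˣ) : CoreRing k p n))
/-- the norm factor `((uᵢ−u_l) t)^p · wᵢ w_l` -/
local notation3 (prettyPrint := false) "nDT" i:max l:max =>
  ((dT i l) ^ p * algebraMap (CoreRing k p n) (reesAlgebra (Ideal.span (Set.range (coreU k p n))))
    ((((isUnit_coreFactor k p n i).unit⁻¹ * (isUnit_coreFactor k p n l).unit⁻¹ : (CoreRing k p n)ˣ)) :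
      CoreRing k p n))
/-- the norm element `N_{i,I}` -/
local notation3 (prettyPrint := false) "normElt" i:max I:max =>
  ((nT i) * (∏ l ∈ Finset.erase I i, (nT l)) * (∏ l ∈ Finset.univ \ I, (nDT i l)))
/-- the inverse `t_l = Ring.inverse (1 + X_l)` in `M_I` -/
local notation3 (prettyPrint := false) "tI" l => Ring.inverse (1 + chartX k p n i I l)

/-! ## `h_M` in the chart ring -/

omit [Fact p.Prime] [CharP k p] in
/-- `h_M` read in `M_I` through the coordinates `chartX`. [OURS · L1 W4.5c] -/
theorem algebraMap_chartDen_eq_prod :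
    algebraMap (MvPolynomial (Fin n) k) (ChartRing k p n i I) (chartDen k p n i I) =
      (1 - chartX k p n i I i ^ (p - 1)) *
        ((∏ l ∈ I.erase i, ((1 + chartX k p n i I l) *
          ((1 + chartX k p n i I l) ^ (p - 1) - chartX k p n i I i ^ (p - 1)))) *
         ∏ l ∈ Finset.univ \ I, ((1 + chartX k p n i I l) *
          ((1 + chartX k p n i I l) ^ (p - 1) - (chartX k p n i I i * chartX k p n i I l) ^ (p - 1)))) := by
  change algebraMap (MvPolynomial (Fin n) k) (ChartRing k p n i I) ((1 - X i ^ (p - 1)) *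
      ((∏ l ∈ I.erase i, ((1 + X l) * ((1 + X l) ^ (p - 1) - X i ^ (p - 1)))) *
        ∏ l ∈ Finset.univ \ I, ((1 + X l) * ((1 + X l) ^ (p - 1) - (X i * X l) ^ (p - 1))))) = _
  simp only [map_mul, map_prod, map_sub, map_add, map_one, map_pow]

/-! ## The algebra isomorphism -/

-- many small localisation facts; individually cheap, long in total
set_option maxHeartbeats 1600000 in
/-- **`(Aₙ[𝔪t])_{(N_{i,I})} ≃ M_I`** carrying `r/1 ↦ β r` for the chart map `β` of F3c-1 (`i ∈ I`). [OURS · L1 W4.5c] -/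
theorem exists_awayEquiv_chartRing (hi : i ∈ I) :
    ∃ (β : CoreRing k p n →ₐ[k] ChartRing k p n i I)
      (A : HomogeneousLocalization.Away (reesGrading (Ideal.span (Set.range (coreU k p n)))) (normElt i I) ≃+*
        ChartRing k p n i I),
      β (coreU k p n i) = chartX k p n i I i ∧
      (∀ l ∈ I.erase i, β (coreU k p n l) * (1 + chartX k p n i I l) = chartX k p n i I i) ∧
      (∀ l ∉ I, β (coreU k p n l) * (1 + chartX k p n i I l) = chartX k p n i I i * chartX k p n i I l) ∧
      (∀ l ∈ I.erase i, β (coreU k p n l) = chartX k p n i I i * (tI l)) ∧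
      (∀ l ∉ I, β (coreU k p n l) = chartX k p n i I i * chartX k p n i I l * (tI l)) ∧
      ∀ r : CoreRing k p n,
        A (((fromZeroRingHom (reesGrading (Ideal.span (Set.range (coreU k p n)))) (.powers (normElt i I))).comp
          (reesGrading.zeroRingHom (Ideal.span (Set.range (coreU k p n))))) r) = β r := by
  have hp0 : p ≠ 0 := (Fact.out : p.Prime).ne_zero
  haveI : IsDomain (CoreRing k p n) := coreRing_isDomain k p n; haveI := chartRing_isDomain k p n i I
  obtain ⟨β, hβi, hβI', hβO', hβIu, hβOu⟩ := exists_chartMap k p n i I hi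
  have hunit : ∀ l, (((isUnit_one_add_chartX k p n i I hi l).unit⁻¹ : (ChartRing k p n i I)ˣ) :
      ChartRing k p n i I) = (tI l) := fun l => by
    rw [← Ring.inverse_unit, IsUnit.unit_spec]
  have hβI : ∀ l ∈ I.erase i, β (coreU k p n l) = chartX k p n i I i * (tI l) := fun l hl => by
    rw [hβIu l hl, hunit]
  have hβO : ∀ l ∉ I, β (coreU k p n l) = chartX k p n i I i * chartX k p n i I l * (tI l) := fun l hl => by
    rw [hβOu l hl, hunit]
  have htI1 : ∀ l, (1 + chartX k p n i I l) * (tI l) = 1 := one_add_chartX_mul_tInv k p n i I hi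
  have htIu : ∀ l, IsUnit (tI l) := fun l => by rw [← hunit]; exact Units.isUnit _
  set d : ℕ := (p - 1) + (I.erase i).card * p + (Finset.univ \ I).card * p with hd
  set G : CoreRing k p n := coreU k p n i ^ (p - 1) * (cw i) * (∏ l ∈ I.erase i, coreT k p n l) *
    (∏ l ∈ Finset.univ \ I, (nD i l)) with hG
  set g : reesAlgebra (Ideal.span (Set.range (coreU k p n))) :=
    (uT i) ^ (p - 1) * algebraMap (CoreRing k p n) _ (cw i) * (∏ l ∈ I.erase i, (nT l)) *
      (∏ l ∈ Finset.univ \ I, (nDT i l)) with hg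
  have hgG : (g : (CoreRing k p n)[X]) = monomial d G := by
    rw [hg, Subalgebra.coe_mul, Subalgebra.coe_mul, Subalgebra.coe_mul, SubmonoidClass.coe_finsetProd,
      SubmonoidClass.coe_finsetProd, Subalgebra.coe_pow, coe_reesT, Subalgebra.coe_algebraMap,
      Polynomial.algebraMap_eq, Polynomial.monomial_pow, one_mul, Polynomial.monomial_mul_C]
    simp_rw [coe_normFactorT, coe_normFactorD]
    rw [BlowupExit.prod_monomial_const_deg, BlowupExit.prod_monomial_const_deg, Polynomial.monomial_mul_monomial,
      Polynomial.monomial_mul_monomial]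
  have hgmem : g ∈ reesGrading (Ideal.span (Set.range (coreU k p n))) d :=
    (mem_reesGrading_iff _).mpr ⟨G, hgG.symm⟩
  have hx : (normElt i I) = (uT i) * g := by
    rw [hg, show (uT i) ^ p = (uT i) * (uT i) ^ (p - 1) from (mul_pow_sub_one hp0 _).symm]
    ring
  letI : Algebra (HomogeneousLocalization.Away (reesGrading (Ideal.span (Set.range (coreU k p n)))) (uT i))
      (HomogeneousLocalization.Away (reesGrading (Ideal.span (Set.range (coreU k p n)))) (normElt i I)) :=
    (awayMap (reesGrading (Ideal.span (Set.range (coreU k p n)))) hgmem hx).toAlgebra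
  haveI : IsLocalization.Away (Away.isLocalizationElem (𝒜 := reesGrading (Ideal.span (Set.range (coreU k p n))))
      (reesT_mem (coreU k p n i) (Ideal.mem_span_range_self (f := coreU k p n) (x := i))) hgmem)
      (HomogeneousLocalization.Away (reesGrading (Ideal.span (Set.range (coreU k p n)))) (normElt i I)) :=
    Away.isLocalization_mul (reesT_mem (coreU k p n i) (Ideal.mem_span_range_self (f := coreU k p n) (x := i)))
      hgmem hx one_ne_zero
  have hβinj : Function.Injective β := chartMap_injective k p n i I hi β hβi hβI' hβO'
  have hTG : coreU k p n i * G ≠ 0 := by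
    have hu : ∀ l, coreU k p n l ≠ 0 := coreU_ne_zero k p n
    have hcw : ∀ l, (cw l) ≠ 0 := fun l => (Units.isUnit _).ne_zero
    have hdiff : ∀ l ∈ Finset.univ \ I, coreU k p n i - coreU k p n l ≠ 0 := by
      intro l hl hzero
      have hli : l ≠ i := fun h => (Finset.mem_sdiff.mp hl).2 (h ▸ hi)
      have h0 : (X i - X l : MvPolynomial (Fin n) k) = 0 := by
        apply algebraMap_coreRing_injective k p n
        rw [map_sub, map_zero]; exact hzero
      exact hli (MvPolynomial.X_injective (sub_eq_zero.mp h0)).symm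
    refine mul_ne_zero (hu i) ?_
    rw [hG]
    refine mul_ne_zero (mul_ne_zero (mul_ne_zero (pow_ne_zero _ (hu i)) (hcw i)) ?_) ?_
    · exact Finset.prod_ne_zero_iff.mpr fun l _ => by
        unfold coreT; exact mul_ne_zero (pow_ne_zero _ (hu l)) (hcw l)
    · exact Finset.prod_ne_zero_iff.mpr fun l hl =>
        mul_ne_zero (pow_ne_zero _ (hdiff l hl)) (mul_ne_zero (hcw i) (hcw l))
  have hnzd : β (coreU k p n i) * β G ∈ nonZeroDivisors (ChartRing k p n i I) := by
    refine mem_nonZeroDivisors_of_ne_zero ?_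
    rw [← map_mul]
    exact fun h => hTG (hβinj (by rw [h, map_zero]))
  set E : ChartRing k p n i I := β (cw i) * (∏ l ∈ I.erase i, ((tI l) ^ p * β (cw l))) *
    (∏ l ∈ Finset.univ \ I, ((tI l) ^ p * (β (cw i) * β (cw l)))) with hE
  have hβG : β G = chartX k p n i I i ^ d * E := by
    have e1 : ∏ l ∈ I.erase i, β (coreT k p n l) =
        (chartX k p n i I i ^ p) ^ (I.erase i).card * ∏ l ∈ I.erase i, ((tI l) ^ p * β (cw l)) := by
      rw [Finset.prod_congr rfl fun l hl => beta_coreT_of_mem_erase k p n i I β hβI l hl, Finset.prod_mul_distrib,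
        Finset.prod_const]
    have e2 : ∏ l ∈ Finset.univ \ I, β (nD i l) =
        (chartX k p n i I i ^ p) ^ (Finset.univ \ I).card *
          ∏ l ∈ Finset.univ \ I, ((tI l) ^ p * (β (cw i) * β (cw l))) := by
      rw [Finset.prod_congr rfl fun l hl =>
        beta_normDiff k p n i I hi β hβi hβO l (Finset.mem_sdiff.mp hl).2, Finset.prod_mul_distrib,
        Finset.prod_const]
    rw [hG, map_mul, map_mul, map_mul, map_pow, hβi, map_prod, map_prod, e1, e2, hE, hd]
    ring
  have hEu : IsUnit E := by
    have hcwu : ∀ l, IsUnit (β (cw l)) := fun l => (Units.isUnit _).map β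
    refine ((hcwu i).mul (IsUnit.prod_iff.mpr fun l _ => ((htIu l).pow p).mul (hcwu l))).mul
      (IsUnit.prod_iff.mpr fun l _ => ((htIu l).pow p).mul ((hcwu i).mul (hcwu l)))
  have hinv : ∃ v ∈ (⊤ : Subalgebra k (ChartRing k p n i I)), v * β G = β (coreU k p n i) ^ d := by
    refine ⟨Ring.inverse E, Algebra.mem_top, ?_⟩
    rw [hβG, hβi]
    calc Ring.inverse E * (chartX k p n i I i ^ d * E) = chartX k p n i I i ^ d * (E * Ring.inverse E) := by ring
      _ = chartX k p n i I i ^ d := by rw [Ring.mul_inverse_cancel _ hEu, mul_one]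
  have hβu : ∀ l, ∃ τ : ChartRing k p n i I, β (coreU k p n l) = chartX k p n i I i * τ := by
    intro l
    by_cases hli : l = i
    · refine ⟨1, ?_⟩; rw [hli, mul_one]; exact hβi
    by_cases hlI : l ∈ I
    · exact ⟨(tI l), hβI l (Finset.mem_erase.mpr ⟨hli, hlI⟩)⟩
    · exact ⟨chartX k p n i I l * (tI l), by rw [hβO l hlI, mul_assoc]⟩
  choose τ hτ using hβu
  have hgen : ∀ x ∈ Ideal.span (Set.range (coreU k p n)),
      ∃ u ∈ (⊤ : Subalgebra k (ChartRing k p n i I)), u * β (coreU k p n i) = β x := by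
    intro x hx
    obtain ⟨c, hc⟩ := Ideal.mem_span_range_iff_exists_fun.mp hx
    refine ⟨∑ l, β (c l) * τ l, Algebra.mem_top, ?_⟩
    rw [← hc, map_sum, Finset.sum_mul]
    refine Finset.sum_congr rfl fun l _ => ?_
    rw [map_mul, hτ l, hβi]; ring
  set hM : ChartRing k p n i I := IsLocalization.Away.invSelf (S := ChartRing k p n i I) (chartDen k p n i I)
    with hhM
  have hhM1 : algebraMap (MvPolynomial (Fin n) k) (ChartRing k p n i I) (chartDen k p n i I) * hM = 1 :=
    IsLocalization.Away.mul_invSelf _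
  set gens : Set (ChartRing k p n i I) := Set.range (chartX k p n i I) ∪ {hM} with hgens
  have hMgens : hM ∈ gens := Set.mem_union_right _ (Set.mem_singleton hM)
  have hS : (⊤ : Subalgebra k (ChartRing k p n i I)) ≤ Algebra.adjoin k gens := by
    intro z _
    obtain ⟨⟨a, y⟩, hz⟩ := IsLocalization.surj (Submonoid.powers (chartDen k p n i I)) z
    obtain ⟨m, hm⟩ := y.2
    have hz' : z = algebraMap (MvPolynomial (Fin n) k) (ChartRing k p n i I) a * hM ^ m := by
      change z * algebraMap _ _ (y : MvPolynomial (Fin n) k) = algebraMap _ _ a at hz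
      rw [← hm, map_pow] at hz
      calc z = z * (algebraMap (MvPolynomial (Fin n) k) (ChartRing k p n i I) (chartDen k p n i I) * hM) ^ m := by
            rw [hhM1, one_pow, mul_one]
        _ = z * algebraMap (MvPolynomial (Fin n) k) (ChartRing k p n i I) (chartDen k p n i I) ^ m * hM ^ m := by
            rw [mul_pow, mul_assoc]
        _ = _ := by rw [hz]
    rw [hz']
    refine Subalgebra.mul_mem _ ?_
      (Subalgebra.pow_mem _ (Algebra.subset_adjoin hMgens) m)
    have ha : (IsScalarTower.toAlgHom k (MvPolynomial (Fin n) k) (ChartRing k p n i I)) a ∈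
        Algebra.adjoin k (Set.range (chartX k p n i I)) := by
      have e : Algebra.adjoin k (Set.range (chartX k p n i I)) =
          (Algebra.adjoin k (Set.range (X : Fin n → MvPolynomial (Fin n) k))).map
            (IsScalarTower.toAlgHom k (MvPolynomial (Fin n) k) (ChartRing k p n i I)) := by
        rw [AlgHom.map_adjoin, ← Set.range_comp]; rfl
      rw [e, MvPolynomial.adjoin_range_X]
      exact ⟨a, Algebra.mem_top, rfl⟩
    exact Algebra.adjoin_mono Set.subset_union_left ha
  obtain ⟨p', hp'⟩ : ∃ p', p = p' + 1 := Nat.exists_eq_succ_of_ne_zero hp0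
  have hpp : p - 1 = p' := by omega
  have hmemU : ∀ l, coreU k p n l ∈ Ideal.span (Set.range (coreU k p n)) := fun l =>
    Ideal.mem_span_range_self (f := coreU k p n) (x := l)
  have hmemD : ∀ l, coreU k p n i - coreU k p n l ∈ Ideal.span (Set.range (coreU k p n)) := fun l =>
    Ideal.sub_mem _ (hmemU i) (hmemU l)
  have hmemPowU : ∀ l (m : ℕ), coreU k p n l ^ m * (cw l) ∈ Ideal.span (Set.range (coreU k p n)) ^ m :=
    fun l m => Ideal.mul_mem_right _ _ (Ideal.pow_mem_pow (hmemU l) m)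
  have hmemT : ∀ l, coreT k p n l ∈ Ideal.span (Set.range (coreU k p n)) ^ p := coreT_mem_pow k p n
  have hmemN : ∀ l, (nD i l) ∈ Ideal.span (Set.range (coreU k p n)) ^ p := normDiff_mem_pow k p n i
  have hmemProdT : ∀ S : Finset (Fin n), (∏ l ∈ S, coreT k p n l) ∈
      Ideal.span (Set.range (coreU k p n)) ^ (S.card * p) := fun S => by
    rw [pow_mul', ← Finset.prod_const]; exact Ideal.prod_mem_prod fun l _ => hmemT l
  have hmemProdN : ∀ S : Finset (Fin n), (∏ l ∈ S, (nD i l)) ∈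
      Ideal.span (Set.range (coreU k p n)) ^ (S.card * p) := fun S => by
    rw [pow_mul', ← Finset.prod_const]; exact Ideal.prod_mem_prod fun l _ => hmemN l
  have hdict : ∀ t ∈ gens, ∃ (μ e e' : ℕ) (F : CoreRing k p n), F ∈ Ideal.span (Set.range (coreU k p n)) ^ μ ∧
      t * β (coreU k p n i) ^ (μ + d * e) * β G ^ e' = β F * β G ^ e * β (coreU k p n i) ^ (d * e') := by
    rintro t (⟨l, rfl⟩ | ht)
    · by_cases hli : l = i
      · refine ⟨0, 0, 0, coreU k p n i, by rw [pow_zero, Ideal.one_eq_top]; exact Submodule.mem_top, ?_⟩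
        rw [hli]
        simp only [Nat.mul_zero, add_zero, pow_zero, mul_one]
        exact hβi.symm
      by_cases hlI : l ∈ I
      · have hl : l ∈ I.erase i := Finset.mem_erase.mpr ⟨hli, hlI⟩
        set G' : CoreRing k p n := coreU k p n i ^ (p - 1) * (cw i) *
          ((coreU k p n l ^ (p - 1) * (cw l)) * ∏ l' ∈ (I.erase i).erase l, coreT k p n l') *
          (∏ l ∈ Finset.univ \ I, (nD i l)) with hG'
        have hGG' : G = coreU k p n l * G' := by
          rw [hG, hG', ← Finset.mul_prod_erase _ _ hl]
          unfold coreT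
          rw [← mul_pow_sub_one hp0 (coreU k p n l)]
          ring
        refine ⟨d, 0, 1, (coreU k p n i - coreU k p n l) * G', ?_, ?_⟩
        · have hm : (coreU k p n i - coreU k p n l) * G' ∈ Ideal.span (Set.range (coreU k p n)) ^
              (1 + ((p - 1) + ((p - 1) + ((I.erase i).erase l).card * p) + (Finset.univ \ I).card * p)) := by
            rw [pow_add, pow_add, pow_add, pow_add, pow_one]
            refine Ideal.mul_mem_mul (hmemD l) (Ideal.mul_mem_mul (Ideal.mul_mem_mul (hmemPowU i _)
              (Ideal.mul_mem_mul (hmemPowU l _) (hmemProdT _))) (hmemProdN _))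
          have hexp : 1 + ((p - 1) + ((p - 1) + ((I.erase i).erase l).card * p) + (Finset.univ \ I).card * p) = d := by
            rw [Finset.card_erase_of_mem hl, hd, hpp, hp']
            obtain ⟨c', hc'⟩ : ∃ c', (I.erase i).card = c' + 1 :=
              Nat.exists_eq_succ_of_ne_zero (by have := Finset.card_pos.mpr ⟨l, hl⟩; omega)
            rw [hc', Nat.add_sub_cancel]
            ring
          rw [← hexp]; exact hm
        · simp only [Nat.mul_zero, add_zero, pow_zero, pow_one, mul_one]
          rw [hGG', map_mul β (coreU k p n l) G', map_mul β (coreU k p n i - coreU k p n l) G',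
            ← chartX_mul_beta_coreU k p n i I hi β hβi hβI l hl]
          ring
      · set G'' : CoreRing k p n := coreU k p n i ^ (p - 1) * (cw i) * (∏ l ∈ I.erase i, coreT k p n l) *
          (((coreU k p n i - coreU k p n l) ^ (p - 1) * ((cw i) * (cw l))) *
            ∏ l' ∈ (Finset.univ \ I).erase l, (nD i l')) with hG''
        have hl' : l ∈ Finset.univ \ I := Finset.mem_sdiff.mpr ⟨Finset.mem_univ l, hlI⟩
        have hGG'' : G = (coreU k p n i - coreU k p n l) * G'' := by
          rw [hG, hG'', ← Finset.mul_prod_erase _ _ hl', ← mul_pow_sub_one hp0 (coreU k p n i - coreU k p n l)]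
          ring
        refine ⟨d, 0, 1, coreU k p n l * G'', ?_, ?_⟩
        · have hmemPowD : (coreU k p n i - coreU k p n l) ^ (p - 1) * ((cw i) * (cw l)) ∈
              Ideal.span (Set.range (coreU k p n)) ^ (p - 1) :=
            Ideal.mul_mem_right _ _ (Ideal.pow_mem_pow (hmemD l) _)
          have hm : coreU k p n l * G'' ∈ Ideal.span (Set.range (coreU k p n)) ^
              (1 + ((p - 1) + (I.erase i).card * p + ((p - 1) + ((Finset.univ \ I).erase l).card * p))) := by
            rw [pow_add, pow_add, pow_add, pow_add, pow_one]
            refine Ideal.mul_mem_mul (hmemU l) (Ideal.mul_mem_mul (Ideal.mul_mem_mul (hmemPowU i _) (hmemProdT _))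
              (Ideal.mul_mem_mul hmemPowD (hmemProdN _)))
          have hexp : 1 + ((p - 1) + (I.erase i).card * p + ((p - 1) + ((Finset.univ \ I).erase l).card * p)) = d := by
            rw [Finset.card_erase_of_mem hl', hd, hpp, hp']
            obtain ⟨c', hc'⟩ : ∃ c', (Finset.univ \ I).card = c' + 1 :=
              Nat.exists_eq_succ_of_ne_zero (by have := Finset.card_pos.mpr ⟨l, hl'⟩; omega)
            rw [hc', Nat.add_sub_cancel]
            ring
          rw [← hexp]; exact hm
        · simp only [Nat.mul_zero, add_zero, pow_zero, pow_one, mul_one]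
          rw [hGG'', map_mul β (coreU k p n i - coreU k p n l) G'', map_mul β (coreU k p n l) G'',
            ← chartX_mul_beta_coreDiff k p n i I hi β hβi hβO l hlI]
          ring
    · rw [Set.mem_singleton_iff] at ht
      rw [ht]
      set Fh : CoreRing k p n := (cw i) * (∏ l ∈ I.erase i, coreT k p n l) *
        (∏ l ∈ Finset.univ \ I, ((coreU k p n i - coreU k p n l) ^ p * (cw l))) with hFh
      set E' : ChartRing k p n i I := β (cw i) * (∏ l ∈ I.erase i, ((tI l) ^ p * β (cw l))) *
        (∏ l ∈ Finset.univ \ I, ((tI l) ^ p * β (cw l))) with hE'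
      have hβFh : β Fh = chartX k p n i I i ^ ((I.erase i).card * p + (Finset.univ \ I).card * p) * E' := by
        have e1 : ∏ l ∈ I.erase i, β (coreT k p n l) =
            (chartX k p n i I i ^ p) ^ (I.erase i).card * ∏ l ∈ I.erase i, ((tI l) ^ p * β (cw l)) := by
          rw [Finset.prod_congr rfl fun l hl => beta_coreT_of_mem_erase k p n i I β hβI l hl,
            Finset.prod_mul_distrib, Finset.prod_const]
        have e2' : ∀ l ∈ Finset.univ \ I, β ((coreU k p n i - coreU k p n l) ^ p * (cw l)) =
            chartX k p n i I i ^ p * ((tI l) ^ p * β (cw l)) := fun l hl => by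
          rw [map_mul, map_pow, beta_coreDiff k p n i I hi β hβi hβO l (Finset.mem_sdiff.mp hl).2, mul_pow,
            mul_assoc]
        have e2 : ∏ l ∈ Finset.univ \ I, β ((coreU k p n i - coreU k p n l) ^ p * (cw l)) =
            (chartX k p n i I i ^ p) ^ (Finset.univ \ I).card * ∏ l ∈ Finset.univ \ I, ((tI l) ^ p * β (cw l)) := by
          rw [Finset.prod_congr rfl e2', Finset.prod_mul_distrib, Finset.prod_const]
        rw [hFh, map_mul, map_mul, map_prod, map_prod, e1, e2, hE']
        ring
      have hden : algebraMap (MvPolynomial (Fin n) k) (ChartRing k p n i I) (chartDen k p n i I) * E' = 1 := by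
        rw [algebraMap_chartDen_eq_prod, hE']
        calc (1 - chartX k p n i I i ^ (p - 1)) *
              ((∏ l ∈ I.erase i, ((1 + chartX k p n i I l) * ((1 + chartX k p n i I l) ^ (p - 1) - chartX k p n i I i ^ (p - 1)))) *
               ∏ l ∈ Finset.univ \ I, ((1 + chartX k p n i I l) *
                ((1 + chartX k p n i I l) ^ (p - 1) - (chartX k p n i I i * chartX k p n i I l) ^ (p - 1)))) *
              (β (cw i) * (∏ l ∈ I.erase i, ((tI l) ^ p * β (cw l))) *
                (∏ l ∈ Finset.univ \ I, ((tI l) ^ p * β (cw l))))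
            = ((1 - chartX k p n i I i ^ (p - 1)) * β (cw i)) *
              ((∏ l ∈ I.erase i, ((1 + chartX k p n i I l) * ((1 + chartX k p n i I l) ^ (p - 1) -
                  chartX k p n i I i ^ (p - 1)))) * (∏ l ∈ I.erase i, ((tI l) ^ p * β (cw l)))) *
              ((∏ l ∈ Finset.univ \ I, ((1 + chartX k p n i I l) *
                ((1 + chartX k p n i I l) ^ (p - 1) - (chartX k p n i I i * chartX k p n i I l) ^ (p - 1)))) *
                (∏ l ∈ Finset.univ \ I, ((tI l) ^ p * β (cw l)))) := by ring
          _ = ((1 - chartX k p n i I i ^ (p - 1)) * β (cw i)) *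
              (∏ l ∈ I.erase i, (((1 + chartX k p n i I l) * ((1 + chartX k p n i I l) ^ (p - 1) -
                  chartX k p n i I i ^ (p - 1))) * ((tI l) ^ p * β (cw l)))) *
              (∏ l ∈ Finset.univ \ I, (((1 + chartX k p n i I l) *
                ((1 + chartX k p n i I l) ^ (p - 1) - (chartX k p n i I i * chartX k p n i I l) ^ (p - 1))) *
                  ((tI l) ^ p * β (cw l)))) := by
              rw [← Finset.prod_mul_distrib, ← Finset.prod_mul_distrib]
          _ = 1 := by
              rw [one_sub_pow_mul_beta_coreFactorInv k p n i I β hβi,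
                Finset.prod_eq_one fun l hl => chartFactor_mul_eq_one_of_mem_erase k p n i I hi β hβI l hl,
                Finset.prod_eq_one fun l hl =>
                  chartFactor_mul_eq_one_of_not_mem k p n i I hi β hβO l (Finset.mem_sdiff.mp hl).2]
              ring
      have hMeq : hM = E' :=
        (IsLocalization.Away.algebraMap_isUnit (S := ChartRing k p n i I) (chartDen k p n i I)).mul_left_cancel
          (hhM1.trans hden.symm)
      refine ⟨(I.erase i).card * p + (Finset.univ \ I).card * p, 0, 0, Fh, ?_, ?_⟩
      · rw [hFh, pow_add]
        refine Ideal.mul_mem_mul (Ideal.mul_mem_left _ _ (hmemProdT _)) ?_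
        rw [pow_mul', ← Finset.prod_const]
        exact Ideal.prod_mem_prod fun l _ => Ideal.mul_mem_right _ _ (Ideal.pow_mem_pow (hmemD l) p)
      · simp only [Nat.mul_zero, add_zero, pow_zero, mul_one]
        rw [hβFh, hMeq, hβi, mul_comm]
  obtain ⟨eE, heE⟩ := BlowupExit.exists_ringEquiv_subalgebra_of_coverData_deg (coreU k p n i)
    (Ideal.mem_span_range_self (f := coreU k p n) (x := i)) d g hgmem G hgG
    (HomogeneousLocalization.Away (reesGrading (Ideal.span (Set.range (coreU k p n)))) (normElt i I))
    β hβinj hnzd ⊤ (fun _ => Algebra.mem_top) hgen hinv gens hS hdict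
  refine ⟨β, eE.trans Subalgebra.topEquiv.toRingEquiv, hβi, hβI', hβO', hβI, hβO, fun r => ?_⟩
  have hr := heE r
  rw [RingHom.algebraMap_toAlgebra] at hr
  have hbase : awayMap (reesGrading (Ideal.span (Set.range (coreU k p n)))) hgmem hx
      (reesChartBase (coreU k p n i) (Ideal.mem_span_range_self (f := coreU k p n) (x := i)) r) =
      ((fromZeroRingHom (reesGrading (Ideal.span (Set.range (coreU k p n)))) (.powers (normElt i I))).comp
        (reesGrading.zeroRingHom (Ideal.span (Set.range (coreU k p n))))) r := by
    change awayMap _ hgmem hx ((fromZeroRingHom _ _) (reesGrading.zeroRingHom _ r)) = _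
    rw [awayMap_fromZeroRingHom]
    rfl
  rw [← hbase]
  change ((eE _ : (⊤ : Subalgebra k (ChartRing k p n i I))) : ChartRing k p n i I) = β r
  exact hr

end Summit.ResolutionOfSingularities.ResolutionOfSingularities.Theorems.WildQuotientResolution.ConductorOne

end
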